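import Summits.QuantumFields.YangMills.Theorems.FluctuationComparisonRegPrIntLOrganTangentSeedHClause
import HarnessLib

/-!
# Crux `FluctuationComparisonRegPrIntL` (stmt-QuantumFields-20520, rung R3), PATH-B organ, H-currency cone — (L29) «WINDOW ALONG A RELATIONAL LAW PATH ∕ SQUARE»
# (knit-side fact for the (I-law) dock ✓(L28a∕b): interior points of an admissible coarse one-bond path∕square stay in a slightly larger plaquette window), INSTANCE-FREE

Cell `ym3-torus` (YM ladder rung R3 = continuum `SU(2)` Yang–Mills on the three-torus — a RUNG: NOT d = 4, NOT infinite volume, NOT a mass gap, NOT Clay).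
Width seat `ym-ust-20520-w5` (gen 24), `--supports stmt-QuantumFields-20520 --as helper`, count-neutral, no registry ∕ binder ∕ `Lines/` edit, DEFINITION-FREE,
default heartbeats.  Over lit `T4ExpWindowSmallField` (`plaqSmall_of_bdev_le`, `dist1_expPt_le_of_mem_cube`), `T4TiltOscillation.bdev`, `T4CubePoincare.cube`.

WHAT.  For a RELATIONAL one-bond exponential law path `X` from `U` at bond `B′` with move `m′` (`(∀ s e, e ≠ B′ → X s e = U e) ∧ (∀ s, X s B′ = U B′·expPt (s•m′))`, the shape
the (I-law) blocks of ✓(L28a∕b) quantify over — NO `Function.update`, NO `DecidableEq`): ★`plaqSmall_relPath` — `PlaqSmall θ₁ U ⟹ PlaqSmall (θ₁ + 4·(√3·(|s|·‖m′‖))) (X s)` for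
every real `s` (so on `Set.Ioo (-1) 2`, `|s| < 2`); ★`plaqSmall_relSquare` — the two-parameter version for the relational square `(Y, X)` (`Y` the `B`-path from `V00`, `X s s′` its
`B′`-move): `PlaqSmall (θ₁ + 4·(√3·(|s|·‖m‖)) + 4·(√3·(|s′|·‖m′‖))) (X s s′)`.  With `‖m‖, ‖m′‖ ≤ rc·θ_j∕4`, `|s|, |s′| ≤ 2` and the `θ_j∕4` corners this keeps every path point
`PlaqSmall ((1 + 16√3·rc)·θ_j∕4)`-small — the «window along the path» the knit needs to feed ✓p814778∕✓p815882 into the dock's `hpath`∕`hsqpath`.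

HONEST FRAMING: lattice-geometry bookkeeping [folklore]; nothing of Bałaban's analysis is asserted or proved; `SpreadFibreLawH(J)` ∕ `OrganDischargeInputsHJ` are HYPOTHESIS rows;
the five registered stubs of `Lines/semiclassical_s2beta.lean`, crux 20520 and `YM3TorusSU2` are NOT proved; registry untouched; rung R3 = SU(2) YM₃ on T³ at fixed lattice data —
NOT d = 4, NOT infinite volume, NOT a mass gap, NOT Clay; the Yang–Mills mass gap is NOT proved.  [folklore].
-/

set_option autoImplicit false

noncomputable section

namespace Summit.QuantumFields.YangMills.Theorems.OrganTangentRelPathWindow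

open Set Function
open Literature.MathematicalPhysics.QuantumFieldTheory.Balaban1983to89
open T4CubeChartExp (expPt)
open T4CubePoincare (cube mem_cube_iff)
open T4ExpWindowSmallField (plaqSmall_of_bdev_le dist1_expPt_le_of_mem_cube)
open T4TiltOscillation (bdev)

variable {P : Params} {j : ℕ}

/-- `s • m′` lies in the sup-norm cube of radius `|s|·‖m′‖`. [folklore] -/
theorem smul_mem_cube (s : ℝ) (m' : Fin 3 → ℝ) : s • m' ∈ cube 3 (|s| * ‖m'‖) := by
  rw [mem_cube_iff]
  intro i
  rw [Pi.smul_apply, smul_eq_mul, abs_mul]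
  exact mul_le_mul_of_nonneg_left ((Real.norm_eq_abs _).symm.le.trans (norm_le_pi_norm m' i)) (abs_nonneg s)

/-- `dist1 (expPt (s • m′)) ≤ √3·(|s|·‖m′‖)`. [folklore] -/
theorem dist1_expPt_smul_le' (s : ℝ) (m' : Fin 3 → ℝ) : dist1 (expPt (s • m')) ≤ Real.sqrt 3 * (|s| * ‖m'‖) :=
  dist1_expPt_le_of_mem_cube (smul_mem_cube s m')

/-- ★ **WINDOW ALONG A RELATIONAL ONE-BOND LAW PATH**: `PlaqSmall θ₁ U ⟹ PlaqSmall (θ₁ + 4·(√3·(|s|·‖m′‖))) (X s)` for every real `s`, for any `X` with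
`(∀ s e, e ≠ B′ → X s e = U e)` and `(∀ s, X s B′ = U B′·expPt (s•m′))`. [cite: Balaban1985Averaging, (9) p.19] (bond → plaquette window; [folklore] bookkeeping) -/
theorem plaqSmall_relPath {θ₁ : ℝ} {U : GaugeField P j (Matrix.specialUnitaryGroup (Fin 2) ℂ)} (hU : PlaqSmall θ₁ U)
    {B' : PBond P j} {m' : Fin 3 → ℝ} {X : ℝ → GaugeField P j (Matrix.specialUnitaryGroup (Fin 2) ℂ)}
    (hoff : ∀ s e, e ≠ B' → X s e = U e) (hon : ∀ s, X s B' = U B' * expPt (s • m')) (s : ℝ) :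
    PlaqSmall (θ₁ + 4 * (Real.sqrt 3 * (|s| * ‖m'‖))) (X s) := by
  refine plaqSmall_of_bdev_le hU fun e => ?_
  by_cases he : e = B'
  · subst he
    rw [bdev, hon s, inv_mul_cancel_left]
    exact dist1_expPt_smul_le' s m'
  · rw [bdev, hoff s e he, inv_mul_cancel, GaugeGroup.dist1_one]
    positivity

/-- ★ **WINDOW ALONG A RELATIONAL ONE-BOND SQUARE** (`Y` the `B`-path from `V00`, `X s s′` the `B′`-move of `Y s`). [cite: Balaban1985Averaging, (9) p.19] -/
theorem plaqSmall_relSquare {θ₁ : ℝ} {V00 : GaugeField P j (Matrix.specialUnitaryGroup (Fin 2) ℂ)} (hV : PlaqSmall θ₁ V00)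
    {B B' : PBond P j} {m m' : Fin 3 → ℝ} {Y : ℝ → GaugeField P j (Matrix.specialUnitaryGroup (Fin 2) ℂ)}
    {X : ℝ → ℝ → GaugeField P j (Matrix.specialUnitaryGroup (Fin 2) ℂ)}
    (hYoff : ∀ s e, e ≠ B → Y s e = V00 e) (hYon : ∀ s, Y s B = V00 B * expPt (s • m))
    (hXoff : ∀ s s' e, e ≠ B' → X s s' e = Y s e) (hXon : ∀ s s', X s s' B' = Y s B' * expPt (s' • m')) (s s' : ℝ) :
    PlaqSmall (θ₁ + 4 * (Real.sqrt 3 * (|s| * ‖m‖)) + 4 * (Real.sqrt 3 * (|s'| * ‖m'‖))) (X s s') :=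
  plaqSmall_relPath (U := Y s) (X := fun s' => X s s') (plaqSmall_relPath hV hYoff hYon s) (fun s' e he => hXoff s s' e he) (fun s' => hXon s s') s'

/-- Corollary in the rows' units: corners `PlaqSmall (θ∕4)`, moves `‖m‖, ‖m′‖ ≤ rc·(θ∕4)`, parameters `|s|, |s′| ≤ 2` (e.g. on `Set.Ioo (-1) 2`) ⟹ every square point is
`PlaqSmall ((1 + 16·√3·rc)·(θ∕4))`. [folklore] -/
theorem plaqSmall_relSquare_of_le {θ rc : ℝ} {V00 : GaugeField P j (Matrix.specialUnitaryGroup (Fin 2) ℂ)} (hV : PlaqSmall (θ / 4) V00)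
    {B B' : PBond P j} {m m' : Fin 3 → ℝ} (hm : ‖m‖ ≤ rc * (θ / 4)) (hm' : ‖m'‖ ≤ rc * (θ / 4))
    {Y : ℝ → GaugeField P j (Matrix.specialUnitaryGroup (Fin 2) ℂ)} {X : ℝ → ℝ → GaugeField P j (Matrix.specialUnitaryGroup (Fin 2) ℂ)}
    (hYoff : ∀ s e, e ≠ B → Y s e = V00 e) (hYon : ∀ s, Y s B = V00 B * expPt (s • m))
    (hXoff : ∀ s s' e, e ≠ B' → X s s' e = Y s e) (hXon : ∀ s s', X s s' B' = Y s B' * expPt (s' • m')) {s s' : ℝ} (hs : |s| ≤ 2) (hs' : |s'| ≤ 2) :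
    PlaqSmall ((1 + 16 * Real.sqrt 3 * rc) * (θ / 4)) (X s s') := by
  have h := plaqSmall_relSquare hV hYoff hYon hXoff hXon s s'
  have h3 : 0 ≤ Real.sqrt 3 := Real.sqrt_nonneg 3
  have e1 : |s| * ‖m‖ ≤ 2 * (rc * (θ / 4)) := mul_le_mul hs hm (norm_nonneg _) (by norm_num)
  have e2 : |s'| * ‖m'‖ ≤ 2 * (rc * (θ / 4)) := mul_le_mul hs' hm' (norm_nonneg _) (by norm_num)
  intro p
  refine lt_of_lt_of_le (h p) ?_
  nlinarith [mul_le_mul_of_nonneg_left e1 h3, mul_le_mul_of_nonneg_left e2 h3]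

/-- The one-parameter corollary: `PlaqSmall (θ∕4) U`, `‖m′‖ ≤ rc·(θ∕4)`, `|s| ≤ 2` ⟹ `PlaqSmall ((1 + 8·√3·rc)·(θ∕4)) (X s)`. [folklore] -/
theorem plaqSmall_relPath_of_le {θ rc : ℝ} {U : GaugeField P j (Matrix.specialUnitaryGroup (Fin 2) ℂ)} (hU : PlaqSmall (θ / 4) U)
    {B' : PBond P j} {m' : Fin 3 → ℝ} (hm' : ‖m'‖ ≤ rc * (θ / 4)) {X : ℝ → GaugeField P j (Matrix.specialUnitaryGroup (Fin 2) ℂ)}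
    (hoff : ∀ s e, e ≠ B' → X s e = U e) (hon : ∀ s, X s B' = U B' * expPt (s • m')) {s : ℝ} (hs : |s| ≤ 2) :
    PlaqSmall ((1 + 8 * Real.sqrt 3 * rc) * (θ / 4)) (X s) := by
  have h := plaqSmall_relPath hU hoff hon s
  have h3 : 0 ≤ Real.sqrt 3 := Real.sqrt_nonneg 3
  have e1 : |s| * ‖m'‖ ≤ 2 * (rc * (θ / 4)) := mul_le_mul hs hm' (norm_nonneg _) (by norm_num)
  intro p
  refine lt_of_lt_of_le (h p) ?_
  nlinarith [mul_le_mul_of_nonneg_left e1 h3]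

end Summit.QuantumFields.YangMills.Theorems.OrganTangentRelPathWindow

end
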